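import Summits.RiemannHypothesis.RiemannHypothesis.Theorems.WeilTwoPrimeDeflE72Base
import Literature.NumberTheory.LFunctions.WeilBlockRows
import Literature.NumberTheory.LFunctions.WeilBlockRowsDCFast
import HarnessLib

/-!
# Deflated two-prime certificate E72: rows 104–107 of the even check `D C = I`

`WeilCert.checkDCRow 0` for certificate E72, by `decide +kernel`. Pure proof file.
-/

noncomputable section

namespace Summit.RiemannHypothesis.RiemannHypothesis.Theorems.EvenWinsBeyondArch

open Literature.NumberTheory.LFunctions

set_option maxHeartbeats 0 in
/-- Kernel check of row 104 of the even `D C = I` (certificate E72), linear-traversal form `WeilCert.checkDCRowF`. [folklore] -/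
theorem checkDCRow0_104_weilCertDeflE72 : weilCertDeflE72Base.checkDCRow 0 104 = true :=
  WeilCert.checkDCRow_of_F (by decide +kernel)

set_option maxHeartbeats 0 in
/-- Kernel check of row 105 of the even `D C = I` (certificate E72), linear-traversal form `WeilCert.checkDCRowF`. [folklore] -/
theorem checkDCRow0_105_weilCertDeflE72 : weilCertDeflE72Base.checkDCRow 0 105 = true :=
  WeilCert.checkDCRow_of_F (by decide +kernel)

set_option maxHeartbeats 0 in
/-- Kernel check of row 106 of the even `D C = I` (certificate E72), linear-traversal form `WeilCert.checkDCRowF`. [folklore] -/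
theorem checkDCRow0_106_weilCertDeflE72 : weilCertDeflE72Base.checkDCRow 0 106 = true :=
  WeilCert.checkDCRow_of_F (by decide +kernel)

set_option maxHeartbeats 0 in
/-- Kernel check of row 107 of the even `D C = I` (certificate E72), linear-traversal form `WeilCert.checkDCRowF`. [folklore] -/
theorem checkDCRow0_107_weilCertDeflE72 : weilCertDeflE72Base.checkDCRow 0 107 = true :=
  WeilCert.checkDCRow_of_F (by decide +kernel)


end Summit.RiemannHypothesis.RiemannHypothesis.Theorems.EvenWinsBeyondArch
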